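import Summits.QuantumAdvantage.QuantumAdvantage.Theorems.PurityDialLawJ

/-! # PurityDialLawK — part 11/13 (mechanical split for landing of `PurityDialLaw`; content verbatim; scopes re-opened with their variables) -/

set_option linter.dupNamespace false
noncomputable section

namespace Summit.QuantumAdvantage.QuantumAdvantage.Theorems.PurityDialLaw
open Classical Finset Summit.QuantumAdvantage.AdviceFreeQNC0
open Literature.Computability.MetaComplexity Literature.Computability.MetaComplexity.Smolensky
open Literature.Computability.Complexity (parityFn)

section BlockWeights

/-- total size of a list of block sizes (structural, so that `bsum (k :: ks) = k + bsum ks` definitionally). -/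
def bsum : List ℕ → ℕ
  | [] => 0
  | k :: ks => k + bsum ks

/-- the canonical block-indicator forms `mod q` of consecutive blocks of sizes `ks`: `ℓ_j(u) = wt(u|block j) mod q`. -/
def blockLam (q : ℕ) : (ks : List ℕ) → Fin ks.length → Fin (bsum ks) → ZMod q
  | [] => fun j => j.elim0
  | k :: ks => fun j => Matrix.vecCons
      (Fin.append (fun _ : Fin k => (1 : ZMod q)) (fun _ : Fin (bsum ks) => 0))
      (fun j' => Fin.append (fun _ : Fin k => (0 : ZMod q)) (blockLam q ks j')) j

/-- **BLOCK-WEIGHT FUNCTIONS** (the census classifier's class BLOCK-SYMMETRIC, with an ARBITRARY combiner): `f` on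
consecutive blocks of sizes `ks = [k₁, …, k_K]` is a function of the block weights `(wt(u|B_1), …, wt(u|B_K))` — stated
recursively: the leading block is weight-determined in every fibre, and every co-fibre is a block-weight function of
the remaining blocks.  Contains the symmetric class (`K = 1`), all tensor products / disjunctions / negations of
members (`tensor_mem_blockWtClass`, `bor_mem_blockWtClass`, `not_mem_blockWtClass`), hence §20's generators. -/
def blockWtClass : (ks : List ℕ) → Set ((Fin (bsum ks) → Bool) → Bool)
  | [] => Set.univ
  | k :: ks => {f | (∀ u : Fin (bsum ks) → Bool, WtDetermined (fibreFn f u)) ∧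
      ∀ y : Fin k → Bool, (fun u : Fin (bsum ks) → Bool => f (Fin.append y u)) ∈ blockWtClass ks}

/-- Purity-dial helper `mem_blockWtClass_cons` (lens-4 g6 PurityDialLaw v12 twin; see the enclosing section docstring). -/
theorem mem_blockWtClass_cons {k : ℕ} {ks : List ℕ} (f : (Fin (k + bsum ks) → Bool) → Bool) :
    f ∈ blockWtClass (k :: ks) ↔ (∀ u : Fin (bsum ks) → Bool, WtDetermined (fibreFn f u)) ∧
      ∀ y : Fin k → Bool, (fun u : Fin (bsum ks) → Bool => f (Fin.append y u)) ∈ blockWtClass ks := Iff.rfl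

/-- Purity-dial helper `const_mem_blockWtClass` (lens-4 g6 PurityDialLaw v12 twin; see the enclosing section docstring). -/
theorem const_mem_blockWtClass (b : Bool) : ∀ ks : List ℕ, (fun _ => b) ∈ blockWtClass ks
  | [] => Set.mem_univ _
  | _ :: ks => ⟨fun _ _ _ _ => rfl, fun _ => const_mem_blockWtClass b ks⟩

/-- Purity-dial helper `not_mem_blockWtClass` (lens-4 g6 PurityDialLaw v12 twin; see the enclosing section docstring). -/
theorem not_mem_blockWtClass : ∀ (ks : List ℕ) (f : (Fin (bsum ks) → Bool) → Bool),
    f ∈ blockWtClass ks → (fun z => !f z) ∈ blockWtClass ks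
  | [], _, _ => Set.mem_univ _
  | _ :: ks, _, hf => ⟨fun u z z' h => congrArg (fun b : Bool => !b) (hf.1 u z z' h),
      fun y => not_mem_blockWtClass ks _ (hf.2 y)⟩

/-- one symmetric block: `K = 1`. -/
theorem mem_blockWtClass_single {k : ℕ} (f : (Fin (k + 0) → Bool) → Bool) (hf : WtDetermined f) :
    f ∈ blockWtClass [k] := by
  refine ⟨fun u z z' h => hf _ _ ?_, fun _ => Set.mem_univ _⟩
  change Fin 0 → Bool at u
  show wt (Fin.append z u) = wt (Fin.append z' u)
  rw [wt_append, wt_append, h]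

/-- a symmetric leading block times a member: tensor products of symmetric pieces are in the class. -/
theorem tensor_mem_blockWtClass {k : ℕ} {ks : List ℕ} (g : (Fin k → Bool) → Bool) (hg : WtDetermined g)
    (h : (Fin (bsum ks) → Bool) → Bool) (hh : h ∈ blockWtClass ks) : tensor g h ∈ blockWtClass (k :: ks) := by
  refine ⟨fun u z z' hzz => ?_, fun y => ?_⟩
  · show tensor g h (Fin.append z u) = tensor g h (Fin.append z' u)
    rw [tensor_append, tensor_append, hg z z' hzz]
  · have : (fun u : Fin (bsum ks) → Bool => tensor g h (Fin.append y u)) = if g y = true then h else fun _ => false := by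
      funext u; rw [tensor_append]; cases g y <;> simp
    rw [this]; split_ifs
    · exact hh
    · exact const_mem_blockWtClass false ks

/-- … and disjunctions. -/
theorem bor_mem_blockWtClass {k : ℕ} {ks : List ℕ} (g : (Fin k → Bool) → Bool) (hg : WtDetermined g)
    (h : (Fin (bsum ks) → Bool) → Bool) (hh : h ∈ blockWtClass ks) : bor g h ∈ blockWtClass (k :: ks) := by
  refine ⟨fun u z z' hzz => ?_, fun y => ?_⟩
  · show bor g h (Fin.append z u) = bor g h (Fin.append z' u)
    rw [bor_append, bor_append, hg z z' hzz]
  · have : (fun u : Fin (bsum ks) → Bool => bor g h (Fin.append y u)) = if g y = true then (fun _ => true) else h := by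
      funext u; rw [bor_append]; cases g y <;> simp
    rw [this]; split_ifs
    · exact const_mem_blockWtClass true ks
    · exact hh

/-- Purity-dial helper `linForms_blockLam_zero` (lens-4 g6 PurityDialLaw v12 twin; see the enclosing section docstring). -/
theorem linForms_blockLam_zero {q k : ℕ} {ks : List ℕ} (y : Fin k → Bool) (u : Fin (bsum ks) → Bool) :
    linForms (blockLam q (k :: ks)) (Fin.append y u) 0 = ((wt y : ℕ) : ZMod q) := by
  unfold linForms wt
  show (∑ i : Fin (k + bsum ks), if Fin.append y u i = true then
      Matrix.vecCons (Fin.append (fun _ : Fin k => (1 : ZMod q)) (fun _ : Fin (bsum ks) => 0))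
        (fun j' => Fin.append (fun _ : Fin k => (0 : ZMod q)) (blockLam q ks j')) 0 i else 0) = _
  rw [Matrix.cons_val_zero, Fin.sum_univ_add]
  simp only [Fin.append_left, Fin.append_right, ite_self, sum_const_zero, add_zero]
  rw [natCast_card_filter]

/-- Purity-dial helper `linForms_blockLam_succ` (lens-4 g6 PurityDialLaw v12 twin; see the enclosing section docstring). -/
theorem linForms_blockLam_succ {q k : ℕ} {ks : List ℕ} (y : Fin k → Bool) (u : Fin (bsum ks) → Bool)
    (j : Fin ks.length) :
    linForms (blockLam q (k :: ks)) (Fin.append y u) j.succ = linForms (blockLam q ks) u j := by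
  unfold linForms
  show (∑ i : Fin (k + bsum ks), if Fin.append y u i = true then
      Matrix.vecCons (Fin.append (fun _ : Fin k => (1 : ZMod q)) (fun _ : Fin (bsum ks) => 0))
        (fun j' => Fin.append (fun _ : Fin k => (0 : ZMod q)) (blockLam q ks j')) j.succ i else 0) = _
  rw [Matrix.cons_val_succ, Fin.sum_univ_add]
  simp only [Fin.append_left, Fin.append_right, ite_self, sum_const_zero, zero_add]

/-- **FACTORISATION (PROVED): a block-weight function of degree `≤ d < p^e` (`p` odd) is a function of the `K` block
weights `mod p^e`**, i.e. of `K` linear forms `mod p^e` — by §18's periodicity (`symFn_of_wtDetermined`) applied to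
the leading block in every fibre, and induction over the blocks (co-fibres keep the degree, `fibre_mem_lowDeg_right`). -/
theorem ofForms_of_blockWt (p : ℕ) [hp : Fact p.Prime] (hp2 : p ≠ 2) (e : ℕ) {d : ℕ} (hd : d < p ^ e) :
    ∀ (ks : List ℕ) (f : (Fin (bsum ks) → Bool) → Bool), f ∈ blockWtClass ks → HasDegF p f d →
      ∃ φ : (Fin ks.length → ZMod (p ^ e)) → Bool, f = ofForms (blockLam (p ^ e) ks) φ := by
  haveI : NeZero (p ^ e) := ⟨pow_ne_zero _ hp.out.ne_zero⟩
  intro ks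
  induction ks with
  | nil =>
    intro f _ _
    refine ⟨fun _ => f (fun i => i.elim0), funext fun z => ?_⟩
    have hz : z = fun i => i.elim0 := funext fun i => i.elim0
    rw [hz]; rfl
  | cons k ks ih =>
    intro f hf hdeg
    obtain ⟨hwt, hrest⟩ := hf
    have hG : ∀ s : ℕ, ∃ φ : (Fin ks.length → ZMod (p ^ e)) → Bool,
        (fun u => f (Fin.append (stdPt k s) u)) = ofForms (blockLam (p ^ e) ks) φ :=
      fun s => ih _ (hrest (stdPt k s)) (fibre_mem_lowDeg_right p hdeg (stdPt k s))
    choose φs hφs using hG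
    refine ⟨fun v => φs (v 0).val (fun j => v j.succ), funext fun z => ?_⟩
    rw [← Fin.append_castAdd_natAdd (f := z)]
    set y : Fin k → Bool := fun i => z (Fin.castAdd (bsum ks) i) with hy
    set u : Fin (bsum ks) → Bool := fun j => z (Fin.natAdd k j) with hu
    have hper : f (Fin.append y u) = f (Fin.append (stdPt k (wt y % p ^ e)) u) := by
      have h := congrFun (symFn_of_wtDetermined p hp2 e hd (hwt u) (hasDegF_fibreFn p hdeg u)) y
      simpa only [fibreFn, symFn] using h
    rw [hper, show f (Fin.append (stdPt k (wt y % p ^ e)) u) =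
      (fun u => f (Fin.append (stdPt k (wt y % p ^ e)) u)) u from rfl, hφs]
    show φs (wt y % p ^ e) (linForms (blockLam (p ^ e) ks) u) =
      φs ((linForms (blockLam (p ^ e) (k :: ks)) (Fin.append y u) 0).val)
        (fun j => linForms (blockLam (p ^ e) (k :: ks)) (Fin.append y u) j.succ)
    rw [linForms_blockLam_zero, ZMod.val_natCast]
    congr 1
    funext j
    rw [linForms_blockLam_succ]

/-- **BLOCK-WEIGHT FUNCTIONS WITH AN ARBITRARY COMBINER OBEY A POLYNOMIAL LAW (PROVED).**  For an odd prime `p`,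
`d < p^e` and `K` consecutive blocks: every Boolean function of the `K` block weights of `𝔽_p`-degree `≤ d` on
`m ≥ 2p^{2e}(d + 1 + K(log₂ p^e + 1))` bits is `3`-balanced (factorisation + `relBal_three_ofForms_mod` with the modulus
`q = p^e` decoupled from the degree prime).  With the least `e` (`p^{e−1} ≤ d`) the threshold is
`≤ 2p²d²(d + 1 + K(log₂(pd) + 1))`: polynomial in `d`, LINEAR in the number of blocks, for EVERY combiner — §20's
`B = 4` law covered products and disjunctions only. -/
theorem relBal_three_of_blockWt (p : ℕ) [hp : Fact p.Prime] (hp2 : p ≠ 2) (e : ℕ) {d : ℕ} (hd : d < p ^ e)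
    (ks : List ℕ) (f : (Fin (bsum ks) → Bool) → Bool) (hf : f ∈ blockWtClass ks) (hdeg : HasDegF p f d)
    (hm : 2 * (p ^ e) ^ 2 * (d + 1 + ks.length * (Nat.log 2 (p ^ e) + 1)) ≤ bsum ks) : RelBal 3 f := by
  obtain ⟨φ, hfφ⟩ := ofForms_of_blockWt p hp2 e hd ks f hf hdeg
  haveI : NeZero (p ^ e) := ⟨pow_ne_zero _ hp.out.ne_zero⟩
  have hq2 : (p ^ e).Coprime 2 := Nat.Coprime.pow_left _ ((Nat.coprime_primes hp.out Nat.prime_two).2 hp2)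
  rw [hfφ] at hdeg ⊢
  exact relBal_three_ofForms_mod p hq2 _ _ hdeg hm

/-- the same with the modulus chosen for you (`e = log_p (max d 1) + 1`, `p^e ≤ p·max d 1`): threshold
`2(p·max d 1)²(d + 1 + K(log₂(p·max d 1) + 1))`. -/
theorem relBal_three_of_blockWt' (p : ℕ) [hp : Fact p.Prime] (hp2 : p ≠ 2) {d : ℕ}
    (ks : List ℕ) (f : (Fin (bsum ks) → Bool) → Bool) (hf : f ∈ blockWtClass ks) (hdeg : HasDegF p f d)
    (hm : 2 * (p * max d 1) ^ 2 * (d + 1 + ks.length * (Nat.log 2 (p * max d 1) + 1)) ≤ bsum ks) : RelBal 3 f := by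
  have hp1 : 1 < p := hp.out.one_lt
  set e := Nat.log p (max d 1) + 1 with he
  have hd : d < p ^ e := lt_of_le_of_lt (le_max_left d 1) (Nat.lt_pow_succ_log_self hp1 _)
  have hpe : p ^ e ≤ p * max d 1 := by
    rw [he, pow_succ, mul_comm]
    exact Nat.mul_le_mul_left _ (Nat.pow_log_le_self p (by positivity))
  refine relBal_three_of_blockWt p hp2 e hd ks f hf hdeg (le_trans ?_ hm)
  have hlog : Nat.log 2 (p ^ e) ≤ Nat.log 2 (p * max d 1) := Nat.log_mono_right hpe
  calc 2 * (p ^ e) ^ 2 * (d + 1 + ks.length * (Nat.log 2 (p ^ e) + 1))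
      ≤ 2 * (p * max d 1) ^ 2 * (d + 1 + ks.length * (Nat.log 2 (p ^ e) + 1)) := by gcongr
    _ ≤ 2 * (p * max d 1) ^ 2 * (d + 1 + ks.length * (Nat.log 2 (p * max d 1) + 1)) := by gcongr

end BlockWeights


end Summit.QuantumAdvantage.QuantumAdvantage.Theorems.PurityDialLaw
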